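import Literature.NumberTheory.LFunctions.WeilBochnerRepresentationRH
import Literature.NumberTheory.LFunctions.ZetaFirstZeroCertificate
import HarnessLib

/-!
# HANDOFF, FILE XII-w″: the PAIR BUDGET — under RH a REAL test function pays every zero TWICE, `2‖ĝ(ρ)‖² ≤ Re Q(g)`; even sector =
# the cosine face (cell rh-explicit, TRACK «HANDOFF», seat theory-2 gen13; companion of XII-w `HandoffMellinPinning` p384063 and
# XII-w′ `HandoffMellinPinningEven` p385402, whose oleans the check farm does not serve tonight — hence self-contained, Literature
# imports only; no statement of those files is repeated)

HONEST FRAMING. Nothing here proves or approaches RH; RH is a HYPOTHESIS in every budget statement (labelled in the name).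
Under RH Weil's form is `Q(g) = Σ_ρ m(ρ)‖ĝ(ρ)‖²` over the non-trivial zeros (tree `WeilBochner.weilQuadratic_eq_integral_of_riemannHypothesis`,
Bombieri 2000 §3 (3.2)). XII-w drops all but finitely many zeros (`Σ_{ρ∈Z} m(ρ)‖ĝ(ρ)‖² ≤ Re Q(g)`) and reads the odd sector through
the sine transform; XII-w′ gives the even sector's cosine transform. This file adds the one sentence the cell's EVEN Mellin tables
(E5 … E37, theory-2 gen10 REPORT §4m‴) check and that neither file states:

* `two_mul_norm_sq_weilMellin_le_of_real` — under RH, for a REAL-valued Weil test `g` (any parity) and any non-trivial zero `ρ`: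
  **`2·‖ĝ(ρ)‖² ≤ Re Q(g)`** — the conjugate zero `ρ̄ ≠ ρ` carries the same `‖ĝ‖²` (`ĝ(s̄) = conj ĝ(s)` for real `g`), so a real
  vector of Weil energy `η` has `|ĝ(ρ)| ≤ √(η/2)` at EVERY zero;
* `two_mul_norm_sq_integral_cos_le` — for real EVEN `g`: `2·‖∫ g(t)cos(γt)dt‖² ≤ Re Q(g)` at `γ = Im ρ` (the cosine face, re-derived
  inside the proof); `exists_first_zero_cos_budget` — the same at the tree's certified first zero `γ₁ ∈ [225/16, 227/16]`, so that
  no zero has to be named.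

References: E. Bombieri, Rend. Mat. Acc. Lincei (9) 11 (2000) §3 eq. (3.2) [Bombieri2000Weil]; H. M. Edwards (1974) §6.6 [Edwards1974].
-/

set_option linter.dupNamespace false  -- the mandated namespace repeats `RiemannHypothesis`

noncomputable section

open Complex Set Filter MeasureTheory Literature.NumberTheory.LFunctions
open Literature.NumberTheory.LFunctions.ZetaZeros Literature.NumberTheory.LFunctions.ZetaZeros.riemannZetaNontrivialZeros
open Literature.NumberTheory.LFunctions.WeilBochner
open scoped Real Topology ComplexConjugate ENNReal

namespace Summit.RiemannHypothesis.RiemannHypothesis.Theorems.HandoffMellinPairBudget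

variable {g : ℝ → ℂ}

/-- **THE PAIR BUDGET: a real test pays every zero twice.** Under RH, for a REAL-valued Weil test function `g` (`conj g = g`, any
parity) and every non-trivial zero `ρ`: `2·‖ĝ(ρ)‖² ≤ Re Q(g)`. (Weil's formula under RH is the integral of `‖ĝ(½+it)‖²` against the
zero-height measure; keep only the two atoms `ρ` and `ρ̄` — distinct since `Im ρ ≠ 0`, multiplicities `≥ 1` — and use
`ĝ(ρ̄) = conj ĝ(ρ)`.) [cite: Bombieri2000Weil, §3 eq. (3.2)] -/
theorem two_mul_norm_sq_weilMellin_le_of_real (hRH : _root_.RiemannHypothesis) (hg : IsWeilTest g)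
    (hreal : ∀ t, conj (g t) = g t) {ρ : ℂ} (hρ : ρ ∈ riemannZetaNontrivialZeros) :
    2 * ‖weilMellin g ρ‖ ^ 2 ≤ (weilQuadratic g).re := by
  -- (i) under RH every non-trivial zero is `½ + i·Im`
  have honline : ∀ {σ : ℂ}, σ ∈ riemannZetaNontrivialZeros → σ = 1 / 2 + (σ.im : ℂ) * I := by
    intro σ hσ
    have hre : σ.re = 1 / 2 := by
      refine hRH σ (zeta_eq_zero hσ) ?_ (ne_one hσ)
      rintro ⟨n, rfl⟩
      have h0 := re_pos hσ
      have e : (-2 * ((n : ℂ) + 1)) = ((-2 * ((n : ℝ) + 1) : ℝ) : ℂ) := by push_cast; ring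
      rw [e, Complex.ofReal_re] at h0
      have : (0 : ℝ) ≤ n := n.cast_nonneg
      linarith
    apply Complex.ext
    · simp [hre]
    · simp
  -- (ii) the conjugate zero and the pair as a finset of the subtype
  have hρ' : conj ρ ∈ riemannZetaNontrivialZeros := conj_mem hρ
  have hne : (⟨ρ, hρ⟩ : riemannZetaNontrivialZeros) ≠ ⟨conj ρ, hρ'⟩ := by
    intro h
    have him : ρ.im = (conj ρ).im := by rw [show conj ρ = ρ from (Subtype.mk.inj h).symm]
    rw [Complex.conj_im] at him
    exact im_ne_zero hρ (by linarith)
  set Z : Finset riemannZetaNontrivialZeros := {⟨ρ, hρ⟩, ⟨conj ρ, hρ'⟩} with hZ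
  -- (iii) the finite-sum bound from the zero-height measure (XII-w's argument, for this `Z`)
  obtain ⟨hint, hQ⟩ := weilQuadratic_eq_integral_of_riemannHypothesis hRH hg
  set F : ℝ → ℝ := fun t ↦ ‖weilMellin g (1 / 2 + t * I)‖ ^ 2 with hF
  have hFc : Continuous F := by
    have h1 : Continuous fun t : ℝ ↦ (1 / 2 : ℂ) + t * I := by fun_prop
    exact ((continuous_weilMellin hg.1.continuous hg.2).comp h1).norm.pow 2
  have hF0 : ∀ t, 0 ≤ F t := fun t ↦ by positivity
  have hQre : (weilQuadratic g).re = ∫ t, F t ∂zetaZeroHeightMeasure := by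
    rw [hQ, Complex.ofReal_re]
  have hIl : ∫ t, F t ∂zetaZeroHeightMeasure = (∫⁻ t, ENNReal.ofReal (F t) ∂zetaZeroHeightMeasure).toReal :=
    integral_eq_lintegral_of_nonneg_ae (ae_of_all _ hF0) hFc.aestronglyMeasurable
  have hlin : ∫⁻ t, ENNReal.ofReal (F t) ∂zetaZeroHeightMeasure =
      ∑' σ : riemannZetaNontrivialZeros,
        ((riemannZetaZeroOrder (σ : ℂ)).toNat : ℝ≥0∞) * ENNReal.ofReal (F (σ : ℂ).im) :=
    lintegral_zetaZeroHeightMeasure hFc.measurable.ennreal_ofReal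
  have hfin : ∫⁻ t, ENNReal.ofReal (F t) ∂zetaZeroHeightMeasure ≠ ⊤ :=
    ((hasFiniteIntegral_iff_ofReal (ae_of_all _ hF0)).1 hint.hasFiniteIntegral).ne
  have hle : ∑ σ ∈ Z, ((riemannZetaZeroOrder (σ : ℂ)).toNat : ℝ≥0∞) * ENNReal.ofReal (F (σ : ℂ).im) ≤
      ∫⁻ t, ENNReal.ofReal (F t) ∂zetaZeroHeightMeasure := by
    rw [hlin]
    exact ENNReal.sum_le_tsum Z
  have hterm : ∀ σ ∈ Z, ((riemannZetaZeroOrder (σ : ℂ)).toNat : ℝ≥0∞) * ENNReal.ofReal (F (σ : ℂ).im) ≠ ⊤ :=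
    fun σ _ ↦ ENNReal.mul_ne_top (ENNReal.natCast_ne_top _) ENNReal.ofReal_ne_top
  have hR := ENNReal.toReal_mono hfin hle
  rw [ENNReal.toReal_sum hterm] at hR
  have hFσ : ∀ σ : riemannZetaNontrivialZeros, F (σ : ℂ).im = ‖weilMellin g σ‖ ^ 2 := by
    intro σ
    show ‖weilMellin g (1 / 2 + (((σ : ℂ).im : ℝ) : ℂ) * I)‖ ^ 2 = ‖weilMellin g σ‖ ^ 2
    rw [← honline σ.2]
  have hcast : ∀ σ : riemannZetaNontrivialZeros,
      (((riemannZetaZeroOrder (σ : ℂ)).toNat : ℕ) : ℝ) = (riemannZetaZeroOrder (σ : ℂ) : ℝ) := by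
    intro σ
    have h1 : (((riemannZetaZeroOrder (σ : ℂ)).toNat : ℕ) : ℤ) = riemannZetaZeroOrder (σ : ℂ) :=
      Int.toNat_of_nonneg (by linarith [one_le_order σ.2])
    rw [← Int.cast_natCast, h1]
  have hid : ∀ σ ∈ Z, (((riemannZetaZeroOrder (σ : ℂ)).toNat : ℝ≥0∞) * ENNReal.ofReal (F (σ : ℂ).im)).toReal =
      (riemannZetaZeroOrder (σ : ℂ) : ℝ) * ‖weilMellin g σ‖ ^ 2 := by
    intro σ _
    rw [ENNReal.toReal_mul, ENNReal.toReal_natCast, ENNReal.toReal_ofReal (hF0 _), hcast σ, hFσ σ]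
  rw [Finset.sum_congr rfl hid, ← hIl, ← hQre, hZ, Finset.sum_pair hne] at hR
  -- (iv) the two values coincide for real `g`: ĝ(ρ̄) = conj ĝ(ρ)
  have hconj : weilMellin g (conj ρ) = conj (weilMellin g ρ) := by
    unfold weilMellin
    rw [← integral_conj]
    refine integral_congr_ae (Filter.Eventually.of_forall fun t ↦ ?_)
    show g t * cexp ((conj ρ - 1 / 2) * (t : ℂ)) = conj (g t * cexp ((ρ - 1 / 2) * (t : ℂ)))
    rw [map_mul, hreal t, ← Complex.exp_conj, map_mul, map_sub, Complex.conj_ofReal, map_div₀, map_one,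
      map_ofNat]
  have hval' : ‖weilMellin g (conj ρ)‖ = ‖weilMellin g ρ‖ := by rw [hconj, Complex.norm_conj]
  -- (v) multiplicities ≥ 1
  have hm1 : (1 : ℝ) ≤ riemannZetaZeroOrder ρ := by exact_mod_cast one_le_order hρ
  have hm2 : (1 : ℝ) ≤ riemannZetaZeroOrder (conj ρ) := by exact_mod_cast one_le_order hρ'
  have h0 : 0 ≤ ‖weilMellin g ρ‖ ^ 2 := by positivity
  have e1 : ‖weilMellin g ρ‖ ^ 2 ≤ (riemannZetaZeroOrder ρ : ℝ) * ‖weilMellin g ρ‖ ^ 2 :=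
    le_mul_of_one_le_left h0 hm1
  have e2 : ‖weilMellin g ρ‖ ^ 2 ≤ (riemannZetaZeroOrder (conj ρ) : ℝ) * ‖weilMellin g (conj ρ)‖ ^ 2 := by
    rw [hval']; exact le_mul_of_one_le_left h0 hm2
  have := add_le_add e1 e2
  simpa [two_mul] using this.trans (by simpa using hR)

/-- The «near-null» reading for real vectors: under RH, `Re Q(g) ≤ η` forces `‖ĝ(ρ)‖² ≤ η/2` at every non-trivial zero — the budget
of a real vector is shared by each zero AND its conjugate. [cite: Bombieri2000Weil, §3 eq. (3.2)] -/
theorem norm_sq_weilMellin_le_half_of_real (hRH : _root_.RiemannHypothesis) (hg : IsWeilTest g)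
    (hreal : ∀ t, conj (g t) = g t) {η : ℝ} (hη : (weilQuadratic g).re ≤ η) {ρ : ℂ}
    (hρ : ρ ∈ riemannZetaNontrivialZeros) : ‖weilMellin g ρ‖ ^ 2 ≤ η / 2 := by
  have := two_mul_norm_sq_weilMellin_le_of_real hRH hg hreal hρ
  linarith

/-- **THE COSINE BUDGET (even, real test functions).** Under RH, for a real-valued EVEN Weil test function `g` and a non-trivial
zero `ρ = ½ + iγ`: `2·‖∫ g(t) cos(γt) dt‖² ≤ Re Q(g)` — i.e. `8(∫₀^∞ g cos γt)² ≤ Q(g)`, the inequality the cell's Mellin tables check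
for the EVEN wall vectors (the cosine face `ĝ(½+iγ) = ∫ g cos(γ·)` of XII-w′, re-derived inside the proof since that module is not
importable on the check farm). [cite: Bombieri2000Weil, §3 eq. (3.2) and Thm 2 (the transform)] -/
theorem two_mul_norm_sq_integral_cos_le (hRH : _root_.RiemannHypothesis) (hg : IsWeilTest g)
    (heven : ∀ t, g (-t) = g t) (hreal : ∀ t, conj (g t) = g t) {ρ : ℂ} (hρ : ρ ∈ riemannZetaNontrivialZeros) :
    2 * ‖∫ t : ℝ, g t * (Real.cos (ρ.im * t) : ℂ)‖ ^ 2 ≤ (weilQuadratic g).re := by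
  -- the cosine face of the transform for even tests
  have hcos : ∀ γ : ℝ, weilMellin g (1 / 2 + γ * I) = ∫ t : ℝ, g t * (Real.cos (γ * t) : ℂ) := by
    intro γ
    unfold weilMellin
    have hexp : ∀ t : ℝ, cexp ((1 / 2 + (γ : ℂ) * I - 1 / 2) * (t : ℂ)) =
        (Real.cos (γ * t) : ℂ) + (Real.sin (γ * t) : ℂ) * I := by
      intro t
      have : (1 / 2 + (γ : ℂ) * I - 1 / 2) * (t : ℂ) = ((γ * t : ℝ) : ℂ) * I := by push_cast; ring
      rw [this, Complex.exp_mul_I, ← Complex.ofReal_cos, ← Complex.ofReal_sin]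
    have hcont : Continuous g := hg.1.continuous
    have hci : ∀ (φ : ℝ → ℂ), Continuous φ → Integrable (fun t ↦ g t * φ t) := fun φ hφ ↦
      (hcont.mul hφ).integrable_of_hasCompactSupport (hg.2.mul_right)
    have hcosI : Integrable (fun t : ℝ ↦ g t * (Real.cos (γ * t) : ℂ)) :=
      hci _ (Complex.continuous_ofReal.comp (Real.continuous_cos.comp (continuous_const.mul continuous_id)))
    have hsinI : Integrable (fun t : ℝ ↦ g t * ((Real.sin (γ * t) : ℂ) * I)) :=
      hci _ ((Complex.continuous_ofReal.comp (Real.continuous_sin.comp (continuous_const.mul continuous_id))).mul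
        continuous_const)
    have hsplit : (fun t : ℝ ↦ g t * cexp ((1 / 2 + (γ : ℂ) * I - 1 / 2) * (t : ℂ))) =
        fun t ↦ g t * (Real.cos (γ * t) : ℂ) + g t * ((Real.sin (γ * t) : ℂ) * I) := by
      funext t; rw [hexp t]; ring
    rw [hsplit, integral_add hcosI hsinI]
    have hsin0 : ∫ t : ℝ, g t * ((Real.sin (γ * t) : ℂ) * I) = 0 := by
      set h : ℝ → ℂ := fun t ↦ g t * ((Real.sin (γ * t) : ℂ) * I) with hh
      have hodd' : ∀ t, h (-t) = -h t := fun t ↦ by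
        have : Real.sin (γ * -t) = -Real.sin (γ * t) := by rw [mul_neg, Real.sin_neg]
        simp only [hh, heven, this, Complex.ofReal_neg]; ring
      have h1 : ∫ t, h (-t) = ∫ t, h t := integral_neg_eq_self h volume
      have h2 : ∫ t, h (-t) = -∫ t, h t := by
        rw [← integral_neg]; exact integral_congr_ae (Filter.Eventually.of_forall fun t ↦ hodd' t)
      have h3 : ∫ t, h t = -∫ t, h t := h1.symm.trans h2
      linear_combination h3 / 2
    rw [hsin0, add_zero]
  have hρeq : ρ = 1 / 2 + (ρ.im : ℂ) * I := by
    have hre : ρ.re = 1 / 2 := by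
      refine hRH ρ (zeta_eq_zero hρ) ?_ (ne_one hρ)
      rintro ⟨n, rfl⟩
      have h0 := re_pos hρ
      have e : (-2 * ((n : ℂ) + 1)) = ((-2 * ((n : ℝ) + 1) : ℝ) : ℂ) := by push_cast; ring
      rw [e, Complex.ofReal_re] at h0
      have : (0 : ℝ) ≤ n := n.cast_nonneg
      linarith
    apply Complex.ext
    · simp [hre]
    · simp
  have key := two_mul_norm_sq_weilMellin_le_of_real hRH hg hreal hρ
  rw [hρeq, hcos] at key
  simpa using key

/-- **THE FIRST-ZERO COSINE BUDGET (no zero to be named by the user).** Under RH every real-valued EVEN Weil test `g` satisfies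
`2·‖∫ g(t) cos(γt) dt‖² ≤ Re Q(g)` for some `γ ∈ [225/16, 227/16] = [14.0625, 14.1875]` — the tree's certified bracket of the first
zero (`ZetaFirstZeroCertificate.exists_zero_Icc_first_bracket`): one explicit trigonometric functional bounded by the Weil energy.
[cite: Bombieri2000Weil, §3 eq. (3.2); Edwards1974, §6.6 (the first zero)] -/
theorem exists_first_zero_cos_budget (hRH : _root_.RiemannHypothesis) (hg : IsWeilTest g)
    (heven : ∀ t, g (-t) = g t) (hreal : ∀ t, conj (g t) = g t) :
    ∃ γ ∈ Set.Icc (225 / 16 : ℝ) (227 / 16),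
      2 * ‖∫ t : ℝ, g t * (Real.cos (γ * t) : ℂ)‖ ^ 2 ≤ (weilQuadratic g).re := by
  obtain ⟨γ, hγ, hz⟩ := exists_zero_Icc_first_bracket
  have him : ((1 : ℂ) / 2 + γ * I).im = γ := by simp
  have hρ : (1 : ℂ) / 2 + γ * I ∈ riemannZetaNontrivialZeros := by
    refine mem_of_im_ne_zero hz ?_
    rw [him]
    linarith [hγ.1]
  refine ⟨γ, hγ, ?_⟩
  have := two_mul_norm_sq_integral_cos_le hRH hg heven hreal hρ
  rwa [him] at this

/-- RH-free REFUTATION FORM of the pair budget: a real Weil test `g` and a non-trivial zero `ρ` with `Re Q(g) < 2‖ĝ(ρ)‖²` refute RH.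
(The falsifiable reading of the cell's even/odd Mellin tables.) [cite: Bombieri2000Weil, §3 eq. (3.2)] -/
theorem not_riemannHypothesis_of_two_mul_lt (hg : IsWeilTest g) (hreal : ∀ t, conj (g t) = g t) {ρ : ℂ}
    (hρ : ρ ∈ riemannZetaNontrivialZeros) (hlt : (weilQuadratic g).re < 2 * ‖weilMellin g ρ‖ ^ 2) :
    ¬ _root_.RiemannHypothesis := fun hRH ↦
  absurd (two_mul_norm_sq_weilMellin_le_of_real hRH hg hreal hρ) (not_le.mpr hlt)

end Summit.RiemannHypothesis.RiemannHypothesis.Theorems.HandoffMellinPairBudget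

end
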